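import Mathlib
import HarnessLib
import Summits.HubbardSuperconductivity.HubbardSuperconductivity.Theorems.ComplexGFFStiffnessHypALocalTwoPointFreeEnergyRepresentation

/-!
# Crux `HypALocalTwoPoint`, line `gnv` — the representation `pertZ = Z₀ · exp(fE K)` from the data of a
# chosen tuned seed (`d = 4`; census F1 (iv), the link between `exists_freeEnergy_of_package` and clause 1)

Route `route-HubbardSuperconductivity-ComplexGFFStiffness`, crux item stmt-HubbardSuperconductivity-19155,
registered stub `stub_twoPointGivenZ` (⇐ `FreeEnergyBounds`, p817758).
`…FreeEnergyAt.exists_freeEnergy_of_package` (general `d`) returns, for every `ι`-admissible `K`, a tuned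
`ι`-seed `x₀` with `‖x₀‖ ≤ ρ`, `‖I(K,x₀) − 1‖ ≤ εη^N A⁻¹A_𝒫` and `fE K = log κ + |Λ|λ(x₀) + Log I(K,x₀)`.
In `d = 4` these data give the first clause of `FreeEnergyBounds`:

* **`pertZ_eq_Z0_mul_exp_of_seed`** — `pertZ M K = Z₀ · exp(log κ_{𝟙,𝟙+q(x₀)} + |Λ|·λ(x₀) + Log I(K,x₀))`
  from `IsIotaHam x₀`, `‖x₀‖ ≤ ρ` (so `𝟙 + q(x₀)` is elliptic and the `TorusFRD` clauses apply),
  `‖I − 1‖ ≤ εη^N A⁻¹A_𝒫 < 1` and the continuity of `K` (`pertZ_eq_Z0_mul_exp_freeEnergyPiece`).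

All proved, no `sorry`.

## References
* S. Adams, S. Buchholz, R. Kotecký, S. Müller, arXiv:1910.13564, Thm 2.2, Ch. 4 [AdamsBuchholzKoteckyMuller2019].
-/

noncomputable section

-- `Summit.<Summit>.<Problem>`: single-conjunct summit, the duplicate component is mandated (D-0017).
set_option linter.dupNamespace false

namespace Summit.HubbardSuperconductivity.HubbardSuperconductivity.Theorems.ComplexGFF

open scoped BigOperators ComplexConjugate
open Real Set Finset MeasureTheory
open Literature.MathematicalPhysics.StatisticalMechanics.ComplexGradientGFF4 (D S)
open Literature.MathematicalPhysics.StatisticalMechanics.GradientRG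
open Literature.MathematicalPhysics.StatisticalMechanics.GradientFRD
  (fourierCoeff cExt cExt_of_mem IsElliptic IsUnitSymm InShell iterDiff supNorm conv ellOp isElliptic_one)
open Literature.MathematicalPhysics.StatisticalMechanics.TorusPolymer
  (IsPolymer numBlocks blockOf boxCorner isPolymer_blockOf isConn_blockOf pcirc)
open Literature.Barriers.CriticalPhenomena.LongRangePhi4.Polymer (IsConn components)
open Literature.MathematicalPhysics.QuantumFieldTheory
open Literature.Dynamics.Hyperbolic

variable {M : ℕ} [NeZero M]

section Package

variable {L N n ñ : ℕ}
    {𝒞 : Matrix (Fin 4) (Fin 4) ℝ → ℕ → (Fin 4 → ZMod M) → ℝ} {Mc : ℕ → ℝ}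
    {Cα : (Fin 4 → ℕ) → ℕ → ℝ} {c C : ℝ} {Cℓ : ℕ → ℝ}

/-- **`pertZ M K = Z₀ · exp(log κ + |Λ|λ(x₀) + Log I(K, x₀))` from the data of a tuned `ι`-seed** (module
docstring): the `d = 4` link between conjunct (0) of `exists_freeEnergy_of_package` and the first clause of
`FreeEnergyBounds`. ([ABKM19] (4.7)–(4.12).) -/
theorem pertZ_eq_Z0_mul_exp_of_seed {h : ℝ} [Fact (0 < h)] [Fact (0 < L)]
    (hallA : ∀ A : Matrix (Fin 4) (Fin 4) ℝ, IsElliptic (1 / 2 : ℝ) 2 A →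
        (∀ k, 1 ≤ k → k ≤ N + 1 →
          ∑ x : Fin 4 → ZMod M, 𝒞 A k x = 0 ∧ ∀ x, 𝒞 A k (-x) = 𝒞 A k x) ∧
        (∀ k, 1 ≤ k → k ≤ N + 1 → ∀ φ : (Fin 4 → ZMod M) → ℝ, ∑ x, φ x = 0 →
          0 ≤ ∑ x, ∑ y, φ x * 𝒞 A k (x - y) * φ y) ∧
        (∀ φ : (Fin 4 → ZMod M) → ℝ, ∑ x, φ x = 0 →
          ellOp A (conv (fun x => ∑ k ∈ Finset.Icc 1 (N + 1), 𝒞 A k x) φ) = φ) ∧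
        (∀ k, 1 ≤ k → k ≤ N → Mc k ≤ 0 ∧
          ∀ x : Fin 4 → ZMod M, ((L : ℝ) ^ k) / 2 ≤ (supNorm x : ℝ) →
            𝒞 A k x = Mc k) ∧
        (∀ k, 1 ≤ k → k ≤ N + 1 → ∀ B : Matrix (Fin 4) (Fin 4) ℝ, IsUnitSymm B →
          (∃ ε : ℝ, 0 < ε ∧ ∀ x : Fin 4 → ZMod M,
            ContDiffOn ℝ ⊤ (fun s : ℝ => 𝒞 (A + s • B) k x) (Set.Ioo (-ε) ε)) ∧
          ∀ α : Fin 4 → ℕ, ∑ i, α i ≤ n → ∀ ℓ : ℕ, ∀ x : Fin 4 → ZMod M,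
            abs (iteratedDeriv ℓ (fun s : ℝ => iterDiff α (𝒞 (A + s • B) k) x) 0)
              ≤ Cα α ℓ / (L : ℝ) ^ ((k - 1) * (4 - 2 + ∑ i, α i))) ∧
        (∀ k, 1 ≤ k → k ≤ N + 1 → ∀ j : ℕ, ∀ κ : Fin 4 → ZMod M, κ ≠ 0 → InShell L j κ →
          (j < k →
            c / (L : ℝ) ^ (2 * (4 + ñ) + 1) * (L : ℝ) ^ (2 * j)
                / (L : ℝ) ^ ((k - j) * (4 - 1 + n)) ≤ (fourierCoeff (𝒞 A k) κ).re ∧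
            ‖fourierCoeff (𝒞 A k) κ‖
              ≤ C * (L : ℝ) ^ (2 * (4 + ñ) + 1) * (L : ℝ) ^ (2 * j)
                  / (L : ℝ) ^ ((k - j) * (4 - 1 + n))) ∧
          (k ≤ j →
            c / (L : ℝ) ^ (2 * (4 + ñ) + 1) * (L : ℝ) ^ (2 * k)
                ≤ (fourierCoeff (𝒞 A k) κ).re ∧
            ‖fourierCoeff (𝒞 A k) κ‖ ≤ C * (L : ℝ) ^ (2 * k)) ∧
          ∀ B : Matrix (Fin 4) (Fin 4) ℝ, IsUnitSymm B → ∀ ℓ : ℕ, 1 ≤ ℓ →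
            (j < k →
              ‖iteratedDeriv ℓ (fun s : ℝ => fourierCoeff (𝒞 (A + s • B) k) κ) 0‖
                ≤ Cℓ ℓ * (L : ℝ) ^ (2 * (4 + ñ) + 1) * (L : ℝ) ^ (2 * j)
                    / (L : ℝ) ^ ((k - j) * (4 - 1 + ñ))) ∧
            (k ≤ j →
              ‖iteratedDeriv ℓ (fun s : ℝ => fourierCoeff (𝒞 (A + s • B) k) κ) 0‖
                ≤ Cℓ ℓ * (L : ℝ) ^ (2 * k))))
    {T₀ : ℝ} (hT₀ : T₀ ≤ 1 / 2)
    {A𝒫' A : ℝ} (hA1 : 1 ≤ A) (hA𝒫0 : 0 ≤ A𝒫') (hA𝒫A : A𝒫' ≤ A)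
    {η ε ρ : ℝ} (hη : 0 < η) (hη1 : η ≤ 1) (hε : 0 ≤ ε) (hε1 : ε < 1) (hρ0 : 0 ≤ ρ)
    (hqT₀ : 2 * (4 : ℝ) ^ 2 / (((L ^ (4 * 0) : ℕ) : ℝ) * (fieldWt h (L : ℝ) 4 0 / (L : ℝ) ^ 0) ^ 2) * ρ ≤ T₀)
    {K : (Fin 4 → ℝ) → ℂ} (hK : Continuous K)
    {x₀ : HamSpace ℂ 4 (fieldWt h (L : ℝ) 4 0) ((L : ℝ) ^ 0) (L ^ (4 * 0))} (hι : IsIotaHam (HamSpace.toHam x₀)) (hx₀ρ : ‖x₀‖ ≤ ρ)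
    (hI : ‖(∫ φ, pcirc 1 (fun Y => expNegH (HamSpace.toHam x₀) Y φ)
            (fun X => initKH K (HamSpace.toHam x₀) X φ) Finset.univ
          ∂(tailMeasure (fun jj => 𝒞 ((1 : Matrix (Fin 4) (Fin 4) ℝ) + hamQuadForm (HamSpace.toHam x₀)) jj) N N)) - 1‖ ≤ ε * η ^ N * A⁻¹ * A𝒫') :
    pertZ M K = ((∫ φ : (Fin 4 → ZMod M) → ℝ, Real.exp (-(S 0 φ)) : ℝ) : ℂ) *
      Complex.exp (((((Real.log (formChangeConst (M := M) (1 : Matrix (Fin 4) (Fin 4) ℝ)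
              (1 + hamQuadForm (HamSpace.toHam x₀)))) : ℝ) : ℂ)
          + (Fintype.card (Fin 4 → ZMod M) : ℂ) * (HamSpace.toHam x₀) (Sum.inl ())
          + Complex.log (∫ φ, pcirc 1 (fun Y => expNegH (HamSpace.toHam x₀) Y φ)
            (fun X => initKH K (HamSpace.toHam x₀) X φ) Finset.univ
          ∂(tailMeasure (fun jj => 𝒞 ((1 : Matrix (Fin 4) (Fin 4) ℝ) + hamQuadForm (HamSpace.toHam x₀)) jj) N N)))) := by
  have hA : 0 < A := by linarith
  have hqT : ∑ i, ∑ j, |hamQuadForm (HamSpace.toHam x₀) i j| ≤ 1 / 2 := by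
    rw [← hamTuningMap_of_le hx₀ρ]
    exact ((entrySum_hamTuningMap_le hρ0 x₀).trans hqT₀).trans hT₀
  have hell : IsElliptic (1 / 2 : ℝ) 2 ((1 : Matrix (Fin 4) (Fin 4) ℝ) + hamQuadForm (HamSpace.toHam x₀)) :=
    isElliptic_one_add_hamQuadForm hqT
  obtain ⟨h1o, h1i, h1ii, -⟩ := hallA 1 isElliptic_one
  obtain ⟨hqo, hqi, hqii, -⟩ := hallA _ hell
  have hbound' : ‖(∫ φ, pcirc 1 (fun Y => expNegH (HamSpace.toHam x₀) Y φ)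
            (fun X => initKH K (HamSpace.toHam x₀) X φ) Finset.univ
          ∂(tailMeasure (fun jj => 𝒞 ((1 : Matrix (Fin 4) (Fin 4) ℝ) + hamQuadForm (HamSpace.toHam x₀)) jj) N N)) - 1‖ < 1 := by
    refine hI.trans_lt ?_
    have hηN : η ^ N ≤ 1 := pow_le_one₀ hη.le hη1
    have hAA : A⁻¹ * A𝒫' ≤ 1 := by
      rw [inv_mul_le_iff₀ hA]; linarith
    calc ε * η ^ N * A⁻¹ * A𝒫' = ε * η ^ N * (A⁻¹ * A𝒫') := by ring
      _ ≤ ε * 1 * 1 := by gcongr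
      _ < 1 := by linarith
  exact pertZ_eq_Z0_mul_exp_freeEnergyPiece (n := M) (N := N) (ofReal_re_quad_of_isIotaHam hι)
    (fun k hk => (h1o k (Finset.mem_Icc.1 hk).1 (Finset.mem_Icc.1 hk).2).1)
    (fun k hk => (h1o k (Finset.mem_Icc.1 hk).1 (Finset.mem_Icc.1 hk).2).2)
    (fun k hk => h1i k (Finset.mem_Icc.1 hk).1 (Finset.mem_Icc.1 hk).2) h1ii
    (fun k hk => (hqo k (Finset.mem_Icc.1 hk).1 (Finset.mem_Icc.1 hk).2).1)
    (fun k hk => (hqo k (Finset.mem_Icc.1 hk).1 (Finset.mem_Icc.1 hk).2).2)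
    (fun k hk => hqi k (Finset.mem_Icc.1 hk).1 (Finset.mem_Icc.1 hk).2) hqii
    hK hbound'

end Package

end Summit.HubbardSuperconductivity.HubbardSuperconductivity.Theorems.ComplexGFF

end
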